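import Summits.QuantumFields.BalabanUV.Beta.GAN24.CombTowerEndOfSlots
import Summits.QuantumFields.BalabanUV.Beta.GAN24.KSlotCombChart
import Summits.QuantumFields.BalabanUV.Beta.GAN24.CombChartSlotJunction
import Summits.QuantumFields.BalabanUV.Beta.GAN24.CombSRowsOfSectors

/-!
# `BalabanUV.Beta.GAN24.CombTowerEndOfSlotsK` — binder row G-an2-4 ∕ (CONV-C), TRANSFER-III: THE (III′) END OF THE OWNER's `CombTowerEndOfSlots` WITH ITS
# K-SLOT PAIR DISCHARGED — the G-an2-4 `AllScalesSeq` statement for `TbalOf Lc (JsB12CombShSym hLc N tabs cΛ cB) j` and the wall `↔` at the constructed ∕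
# identified limits, SOCKETED ON THE S-SLOT AND W-SLOT ROWS ONLY (`Lc ≥ 2` added for the K-slot: `KSlotCombChart.kSlotCombSh_holds`)
# (G-an2-4 crux team (2), leaf prover 02 `b2b-balaban-gan24-formalise-leaf-02` gen 77; the K-discharged corollary the OWNER gan24-p1 g46 left to this seat,
# journal [GAN24P1-G46-INTENT-1] ∕ R-2 row L7, leaf-01 g79 A-1 ∕ A-2 ∕ W-4 («ONE home for every K-discharged (III′) END»); one `obtain` per END, nothing else)

HONEST DEPENDENCY (page 1, mandatory): continuum YM on T⁴ ⇐ BetaPertH ∧ nine spine estimates (0/9 proved); BetaPertH ⇐ (D1) ∧ (D4) ∧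
CAP+tail; G-an2-4 gates asym, D1 and NE2/3/4.  HONEST FRAMING (cell contract, verbatim): «discharging `BetaPertH` makes Bałaban's UV
stability UNCONDITIONAL — a real constructive-QFT result; it is NOT the continuum limit and NOT the Clay problem.»
ABSOLUTE RULE (cell charter, verbatim): «No internally-minted statement may enter as a cited fact. Every hypothesis is either kernel-proved in
this package or a verbatim quotation of a PUBLISHED theorem with page reference. The manuscript(s) under audit are NOT citable for their own
disputed steps — they are the thing under adjudication; programme-internal (2001/route/tribunal) claims are never citable.»
NOTHING below is cited; no `def`, no `def … : Prop`, 0 sorry.  NOT IN PRINT; OUR BOOKKEEPING ([folklore] composition BY NAME).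

CONTENT (`d + 1 = 4`; `Lc` odd AND `2 ≤ Lc`; every `SU(N)`, sym record `tabs : SymTables 3 Lc`, `cΛ cB`, channel `(μ, ν)`; units `sfStep Lc j = Lc^j`, `smStep 3 Lc j = Lc^{4j}`).
HYPOTHESES = the OWNER's (hS, hSall) on `unitS_j (ScombOf tabs Lc⁴ (−Lc⁸∕2) cΛ j)` and (hW, hWall) on `unitW_j (WcombOf tabs … j)` (resp. on `unitW_j (WcombOf … j − X j)` in §3),
each at its own rate in `[0,1)` and radius `> 0`; the K-pair `(hK, hKall)` on `unitK_j (GcombSh Lc j)` is SUPPLIED by `KSlotCombChart.kSlotCombSh_holds`.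
* §1 **`exists_allScalesSeq_JsB12CombShSym_of_slots`** — `∃ κ θ, 0 ≤ θ ∧ θ < 1 ∧ AllScalesSeq (j ↦ secondMoment (TbalOf Lc (JsB12CombShSym …) j) μ ν) κ θ` ⟸ (hS, hSall) ∧ (hW, hWall).
* §2 **`d1Drift_JsB12CombShSym_iff_of_slots`** — under the same four rows, `D1Drift Lc (JsB12CombShSym …) Nc μ ν ↔` the identification at the CONSTRUCTED limits (the OWNER's §4),
  and **`d1Drift_JsB12CombShSym_iff_of_slots_perf`** — the same with the resolvent limit IDENTIFIED, `G′_∞ = coDressKAt ρ_c Lc (coDressKSymAt ρ_c Lc (KPerf Lc (sfStep Lc) (smStep 3 Lc) 1))`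
  (`KSlotCombChart.limMKerOf_unitK_GcombSh`).
* §3 **`exists_allScalesSeq_JsB12CombShSym_of_slots_parity`** — §1 with the W-rows asked MODULO ANY localised parity-odd family `X` (the OWNER's §5, link L1 of (α-0) at (III′)).
* §4 **`d1Drift_JsB12CombShSym_iff_lim_eq_of_slots_parity`** ∕ **`d1Drift_JsB12CombShSym_iff_cesaro_of_slots_parity`** — row D1's two READINGS of the wall at the literal on the
  S-∕W-slot rows alone (W modulo `X`), K discharged: `D1Drift … Nc μ ν ↔ lim_j β_j^{μν} = stepBal Nc Lc` (`HessKerDressedCauchy.d1Drift_iff_lim_eq`) and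
  `↔ (Σ_{j<m} β_j)∕m → stepBal Nc Lc` (`D1BFx.RoadEnd.d1Drift_iff_cesaro`) — the K-discharged forms of leaf-01 g79's `CombChartSlotSocket` §2 readings (deferred to this file, their A-2).
* §5 **`exists_allScalesSeq_JsB12CombShSym_of_slots_evenHalf`**, **`d1Drift_JsB12CombShSym_iff_lim_eq_of_slots_evenHalf`**, **`d1Drift_JsB12CombShSym_iff_cesaro_of_slots_evenHalf`** —
  leaf-01 g79's `CombChartSlotJunction` §1–§3 (W-rows asked of the EVEN HALF `½ • (W⁰ + sgnK∘trK∘W⁰)` only) with the K-pair discharged (leaf-01 W-4: «IN YOUR FILE»).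
* §6 (v1.3, gen 79, APPEND-ONLY) **`exists_allScalesSeq_JsB12CombShSym_of_sectors`**, **`d1Drift_JsB12CombShSym_iff_of_sectors`** (`G′_∞` identified: one `rw [← limMKerOf_unitK_GcombSh]`) —
  §1 ∕ §2 with the S-slot pair `(hS, hSall)` on `unitS_j (ScombOf …)` SOCKETED ON road-P2 g56's four SECTOR letters of M.53 `CombSRowsOfSectors.exists_hS_hSall_ScombOf_of_sectors`:
  uniform localisation + all-scales Cauchy rows of the unit tables of the WILSON LINEAGE `combWilsonAt Lc Lc⁴` and of the BORN REMAINDER `combBornOf Lc tabs Lc⁴ (−Lc⁸∕2) cΛ`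
  (M.50 `CombWilsonSector`: `ScombOf = combWilsonAt + combBornOf`); the two S-radii merged to `min` by `StencilSlotOfShapes.locStencil_mono'` (T1 takes ONE `δS`).
WHAT IT IS NOT.  It discharges NO S-slot or W-slot row, NO parity SPLIT, NO value (§4's value identity `lim β = stepBal` is row D1's and is NOT proved here — only its
equivalence with the wall term, given the rows); the displayed rows ARE the (III′) campaign (an2 W-4: not asked); NEVER «G-an2-4 closed»
as (CONV-C); NOT D1, NOT `BetaPertH`, NOT continuum, NOT Clay.  2026-08-25 (v1.2 gen 77 ∕ 79; v1.3 = v1.2 + §6, gen 79, §1–§5 byte-identical).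
-/

noncomputable section

open Literature.MathematicalPhysics.QuantumFieldTheory
open Literature.MathematicalPhysics.QuantumFieldTheory.Balaban1983to89
open Literature.MathematicalPhysics.QuantumFieldTheory.Balaban1983to89.Beta
open Filter Topology
open scoped BigOperators
open RemainderConstAllScales (AllScalesSeq)
open HessKerDressedCauchy (d1Drift_iff_lim_eq)
open ExpKernelCalculus (MKer Decays VertexFamily₂ hessKer)
open AveragingContoursRooted (ctr ctrOff ctrOff_mem_box)
open OneStepResolventKernel (Fib LocStencil)
open OneStepKernelFamily (vertexOfK TbalOf D1Drift)
open WilsonVertex2Sym (wsym22)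
open HessKerDressedLimit (limMKerOf limStOf limTabOf)
open Summit.QuantumFields.BalabanUV.Beta.HessKerDressedUnits (unitK unitS unitW)
open Summit.QuantumFields.BalabanUV.Beta.SymmetrisedStepJets (SymTables)
open Summit.QuantumFields.BalabanUV.Beta.SymmetrisedDressingKernel (coDressKSymAt)
open Summit.QuantumFields.BalabanUV.Beta.AxialDressingRooted (coDressKAt)
open Summit.QuantumFields.BalabanUV.Beta.TameKernelCalculus (Loc trK)
open Summit.QuantumFields.BalabanUV.Beta.BorderedHessian (sgnK)
open Summit.QuantumFields.BalabanUV.Beta.CombChartStepJets (GcombSh ScombOf WcombOf)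
open Summit.QuantumFields.BalabanUV.Beta.CombChartJointEnd (JsB12CombShSym)
open Summit.QuantumFields.BalabanUV.Beta.FP.PerfectObjectsT (KPerf)
open Summit.QuantumFields.BalabanUV.Beta.GAN24.CombesThomas (sfStep smStep)
open Summit.QuantumFields.BalabanUV.Beta.GAN24.CombTowerEndOfSlots (exists_allScalesSeq_JsB12CombShSym_of_kRows_slots d1Drift_JsB12CombShSym_iff_of_kRows_slots
  exists_allScalesSeq_JsB12CombShSym_of_kRows_slots_parity)
open Summit.QuantumFields.BalabanUV.Beta.GAN24.KSlotCombChart (kSlotCombSh_holds limMKerOf_unitK_GcombSh)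
open Summit.QuantumFields.BalabanUV.Beta.D1BFx.RoadEnd (d1Drift_iff_cesaro)
open Summit.QuantumFields.BalabanUV.Beta.GAN24.CombChartSlotJunction (exists_allScalesSeq_JsB12CombShSym_of_kRows_slots_evenHalf
  d1Drift_JsB12CombShSym_iff_lim_eq_of_kRows_slots_evenHalf d1Drift_JsB12CombShSym_iff_cesaro_of_kRows_slots_evenHalf)
open Summit.QuantumFields.BalabanUV.Beta.GAN24.CombWilsonSector (combWilsonAt combBornOf)
open Summit.QuantumFields.BalabanUV.Beta.GAN24.CombSRowsOfSectors (exists_hS_hSall_ScombOf_of_sectors)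
open Summit.QuantumFields.BalabanUV.Beta.GAN24.StencilSlotOfShapes (locStencil_mono')

namespace Summit.QuantumFields.BalabanUV.Beta.GAN24.CombTowerEndOfSlotsK

variable {Lc : ℕ} [NeZero Lc] {Cs cS δS θS Cw cW δW θW : ℝ}

/-! ## §1 The (III′) END on the S- and W-slot rows alone -/

/-- [our object; folklore composition] **THE G-an2-4 END AT ROW D1's LITERAL OF RECORD (III′), K-SLOT DISCHARGED**: for `Lc` odd, `2 ≤ Lc`, every `N`, `tabs`, `cΛ cB`, channel,
the S-slot rows of `unitS_j (ScombOf tabs Lc⁴ (−Lc⁸∕2) cΛ j)` and the W-slot rows of `unitW_j (WcombOf tabs … j)` give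
`∃ κ θ, 0 ≤ θ ∧ θ < 1 ∧ AllScalesSeq (j ↦ secondMoment (TbalOf Lc (JsB12CombShSym hLc N tabs cΛ cB) j) μ ν) κ θ` — the OWNER's
`CombTowerEndOfSlots.exists_allScalesSeq_JsB12CombShSym_of_kRows_slots` with `(hK, hKall)` supplied by `KSlotCombChart.kSlotCombSh_holds`. -/
theorem exists_allScalesSeq_JsB12CombShSym_of_slots (hLc : Odd Lc) (hLc2 : 2 ≤ Lc) (N : ℕ) (tabs : SymTables 3 Lc) (cΛ cB : ℝ)
    (hS : ∀ j, LocStencil (unitS (sfStep Lc j) (smStep 3 Lc j) (ScombOf tabs ((Lc : ℝ) ^ 4) (-((Lc : ℝ) ^ 8 / 2)) cΛ j)) Cs δS)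
    (hSall : ∀ k j, LocStencil (unitS (sfStep Lc (k + j)) (smStep 3 Lc (k + j)) (ScombOf tabs ((Lc : ℝ) ^ 4) (-((Lc : ℝ) ^ 8 / 2)) cΛ (k + j)) -
      unitS (sfStep Lc k) (smStep 3 Lc k) (ScombOf tabs ((Lc : ℝ) ^ 4) (-((Lc : ℝ) ^ 8 / 2)) cΛ k)) (cS * θS ^ k) δS)
    (hW : ∀ j, VertexFamily₂ (unitW (sfStep Lc j) (smStep 3 Lc j)
      (WcombOf tabs ((Lc : ℝ) ^ 4) (-((Lc : ℝ) ^ 8 / 2)) cΛ ((Lc : ℝ) ^ 8) cB ((8 * (N : ℝ) ^ 2)⁻¹ • wsym22 N) j)) Lc Cw δW)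
    (hWall : ∀ k j, VertexFamily₂ (unitW (sfStep Lc (k + j)) (smStep 3 Lc (k + j))
        (WcombOf tabs ((Lc : ℝ) ^ 4) (-((Lc : ℝ) ^ 8 / 2)) cΛ ((Lc : ℝ) ^ 8) cB ((8 * (N : ℝ) ^ 2)⁻¹ • wsym22 N) (k + j)) -
      unitW (sfStep Lc k) (smStep 3 Lc k)
        (WcombOf tabs ((Lc : ℝ) ^ 4) (-((Lc : ℝ) ^ 8 / 2)) cΛ ((Lc : ℝ) ^ 8) cB ((8 * (N : ℝ) ^ 2)⁻¹ • wsym22 N) k)) Lc (cW * θW ^ k) δW)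
    (hδS : 0 < δS) (hδW : 0 < δW) (hθS0 : 0 ≤ θS) (hθS1 : θS < 1) (hθW0 : 0 ≤ θW) (hθW1 : θW < 1) (μ ν : Fin 4) :
    ∃ κ θ : ℝ, 0 ≤ θ ∧ θ < 1 ∧ AllScalesSeq (fun j => B12Beta.secondMoment (TbalOf Lc (JsB12CombShSym hLc N tabs cΛ cB) j) μ ν) κ θ := by
  obtain ⟨C, δK, cK, θK, hδK, hθK0, hθK1, hK, hKall⟩ := kSlotCombSh_holds hLc2
  exact exists_allScalesSeq_JsB12CombShSym_of_kRows_slots hLc N tabs cΛ cB hK hKall hS hSall hW hWall hδK hδS hδW hθK0 hθK1 hθS0 hθS1 hθW0 hθW1 μ ν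

/-! ## §2 The wall ⟺ the identification, on the S- and W-slot rows alone -/

/-- [our object; folklore composition] **THE WALL ⟺ THE IDENTIFICATION AT THE CONSTRUCTED LIMITS, K-SLOT DISCHARGED** (the OWNER's §4 with
`(hK, hKall)` supplied by `kSlotCombSh_holds`; `Lc` odd, `2 ≤ Lc`; every colour `Nc`). -/
theorem d1Drift_JsB12CombShSym_iff_of_slots (hLc : Odd Lc) (hLc2 : 2 ≤ Lc) (N : ℕ) (tabs : SymTables 3 Lc) (cΛ cB : ℝ)
    (hS : ∀ j, LocStencil (unitS (sfStep Lc j) (smStep 3 Lc j) (ScombOf tabs ((Lc : ℝ) ^ 4) (-((Lc : ℝ) ^ 8 / 2)) cΛ j)) Cs δS)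
    (hSall : ∀ k j, LocStencil (unitS (sfStep Lc (k + j)) (smStep 3 Lc (k + j)) (ScombOf tabs ((Lc : ℝ) ^ 4) (-((Lc : ℝ) ^ 8 / 2)) cΛ (k + j)) -
      unitS (sfStep Lc k) (smStep 3 Lc k) (ScombOf tabs ((Lc : ℝ) ^ 4) (-((Lc : ℝ) ^ 8 / 2)) cΛ k)) (cS * θS ^ k) δS)
    (hW : ∀ j, VertexFamily₂ (unitW (sfStep Lc j) (smStep 3 Lc j)
      (WcombOf tabs ((Lc : ℝ) ^ 4) (-((Lc : ℝ) ^ 8 / 2)) cΛ ((Lc : ℝ) ^ 8) cB ((8 * (N : ℝ) ^ 2)⁻¹ • wsym22 N) j)) Lc Cw δW)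
    (hWall : ∀ k j, VertexFamily₂ (unitW (sfStep Lc (k + j)) (smStep 3 Lc (k + j))
        (WcombOf tabs ((Lc : ℝ) ^ 4) (-((Lc : ℝ) ^ 8 / 2)) cΛ ((Lc : ℝ) ^ 8) cB ((8 * (N : ℝ) ^ 2)⁻¹ • wsym22 N) (k + j)) -
      unitW (sfStep Lc k) (smStep 3 Lc k)
        (WcombOf tabs ((Lc : ℝ) ^ 4) (-((Lc : ℝ) ^ 8 / 2)) cΛ ((Lc : ℝ) ^ 8) cB ((8 * (N : ℝ) ^ 2)⁻¹ • wsym22 N) k)) Lc (cW * θW ^ k) δW)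
    (hδS : 0 < δS) (hδW : 0 < δW) (hθS0 : 0 ≤ θS) (hθS1 : θS < 1) (hθW0 : 0 ≤ θW) (hθW1 : θW < 1) (μ ν : Fin 4) (Nc : ℝ) :
    D1Drift Lc (JsB12CombShSym hLc N tabs cΛ cB) Nc μ ν ↔
      B12Beta.secondMoment
        (hessKer (limMKerOf fun j => unitK (sfStep Lc j) (smStep 3 Lc j) (GcombSh (d := 3) Lc j))
          (vertexOfK (limMKerOf fun j => unitK (sfStep Lc j) (smStep 3 Lc j) (GcombSh (d := 3) Lc j)) Lc
            (limStOf fun j => unitS (sfStep Lc j) (smStep 3 Lc j) (ScombOf tabs ((Lc : ℝ) ^ 4) (-((Lc : ℝ) ^ 8 / 2)) cΛ j)))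
          (limTabOf fun j => unitW (sfStep Lc j) (smStep 3 Lc j)
            (WcombOf tabs ((Lc : ℝ) ^ 4) (-((Lc : ℝ) ^ 8 / 2)) cΛ ((Lc : ℝ) ^ 8) cB ((8 * (N : ℝ) ^ 2)⁻¹ • wsym22 N) j))) μ ν =
        B12Normalization.stepBal Nc Lc := by
  obtain ⟨C, δK, cK, θK, hδK, hθK0, hθK1, hK, hKall⟩ := kSlotCombSh_holds hLc2
  exact d1Drift_JsB12CombShSym_iff_of_kRows_slots hLc N tabs cΛ cB hK hKall hS hSall hW hWall hδK hδS hδW hθK0 hθK1 hθS0 hθS1 hθW0 hθW1 μ ν Nc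

/-- [our object; folklore composition] **THE SAME, WITH THE RESOLVENT LIMIT IDENTIFIED**: `G′_∞ = coDressKAt ρ_c Lc (coDressKSymAt ρ_c Lc (KPerf Lc (sfStep Lc) (smStep 3 Lc) 1))`
(`KSlotCombChart.limMKerOf_unitK_GcombSh`; `ρ_c = ctr 4 Lc`). -/
theorem d1Drift_JsB12CombShSym_iff_of_slots_perf (hLc : Odd Lc) (hLc2 : 2 ≤ Lc) (N : ℕ) (tabs : SymTables 3 Lc) (cΛ cB : ℝ)
    (hS : ∀ j, LocStencil (unitS (sfStep Lc j) (smStep 3 Lc j) (ScombOf tabs ((Lc : ℝ) ^ 4) (-((Lc : ℝ) ^ 8 / 2)) cΛ j)) Cs δS)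
    (hSall : ∀ k j, LocStencil (unitS (sfStep Lc (k + j)) (smStep 3 Lc (k + j)) (ScombOf tabs ((Lc : ℝ) ^ 4) (-((Lc : ℝ) ^ 8 / 2)) cΛ (k + j)) -
      unitS (sfStep Lc k) (smStep 3 Lc k) (ScombOf tabs ((Lc : ℝ) ^ 4) (-((Lc : ℝ) ^ 8 / 2)) cΛ k)) (cS * θS ^ k) δS)
    (hW : ∀ j, VertexFamily₂ (unitW (sfStep Lc j) (smStep 3 Lc j)
      (WcombOf tabs ((Lc : ℝ) ^ 4) (-((Lc : ℝ) ^ 8 / 2)) cΛ ((Lc : ℝ) ^ 8) cB ((8 * (N : ℝ) ^ 2)⁻¹ • wsym22 N) j)) Lc Cw δW)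
    (hWall : ∀ k j, VertexFamily₂ (unitW (sfStep Lc (k + j)) (smStep 3 Lc (k + j))
        (WcombOf tabs ((Lc : ℝ) ^ 4) (-((Lc : ℝ) ^ 8 / 2)) cΛ ((Lc : ℝ) ^ 8) cB ((8 * (N : ℝ) ^ 2)⁻¹ • wsym22 N) (k + j)) -
      unitW (sfStep Lc k) (smStep 3 Lc k)
        (WcombOf tabs ((Lc : ℝ) ^ 4) (-((Lc : ℝ) ^ 8 / 2)) cΛ ((Lc : ℝ) ^ 8) cB ((8 * (N : ℝ) ^ 2)⁻¹ • wsym22 N) k)) Lc (cW * θW ^ k) δW)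
    (hδS : 0 < δS) (hδW : 0 < δW) (hθS0 : 0 ≤ θS) (hθS1 : θS < 1) (hθW0 : 0 ≤ θW) (hθW1 : θW < 1) (μ ν : Fin 4) (Nc : ℝ) :
    D1Drift Lc (JsB12CombShSym hLc N tabs cΛ cB) Nc μ ν ↔
      B12Beta.secondMoment
        (hessKer (coDressKAt (ctr (3 + 1) Lc) Lc (coDressKSymAt (ctr (3 + 1) Lc) Lc (KPerf (d := 3) Lc (sfStep Lc) (smStep 3 Lc) 1)))
          (vertexOfK (coDressKAt (ctr (3 + 1) Lc) Lc (coDressKSymAt (ctr (3 + 1) Lc) Lc (KPerf (d := 3) Lc (sfStep Lc) (smStep 3 Lc) 1))) Lc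
            (limStOf fun j => unitS (sfStep Lc j) (smStep 3 Lc j) (ScombOf tabs ((Lc : ℝ) ^ 4) (-((Lc : ℝ) ^ 8 / 2)) cΛ j)))
          (limTabOf fun j => unitW (sfStep Lc j) (smStep 3 Lc j)
            (WcombOf tabs ((Lc : ℝ) ^ 4) (-((Lc : ℝ) ^ 8 / 2)) cΛ ((Lc : ℝ) ^ 8) cB ((8 * (N : ℝ) ^ 2)⁻¹ • wsym22 N) j))) μ ν =
        B12Normalization.stepBal Nc Lc := by
  rw [← limMKerOf_unitK_GcombSh hLc2]
  exact d1Drift_JsB12CombShSym_iff_of_slots hLc hLc2 N tabs cΛ cB hS hSall hW hWall hδS hδW hθS0 hθS1 hθW0 hθW1 μ ν Nc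

/-! ## §3 The END with the W-rows asked modulo any localised parity-odd family, K-slot discharged -/

/-- [our object; folklore composition] **THE (III′) END, K DISCHARGED, W-ROWS MODULO ANY LOCALISED PARITY-ODD FAMILY `X`** (the OWNER's §5 with `(hK, hKall)` supplied by
`kSlotCombSh_holds`; `Lc` odd, `2 ≤ Lc`). -/
theorem exists_allScalesSeq_JsB12CombShSym_of_slots_parity
    (X : ℕ → Fin (3 + 1) → (Fin (3 + 1) → ℤ) → Fin (3 + 1) → (Fin (3 + 1) → ℤ) → MKer (3 + 1) (Fib 3))
    (hX : ∀ j μ ν z, Loc (X j μ 0 ν z)) (hXt : ∀ j μ ν z, trK (X j μ 0 ν z) = -sgnK (X j μ 0 ν z))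
    (hLc : Odd Lc) (hLc2 : 2 ≤ Lc) (N : ℕ) (tabs : SymTables 3 Lc) (cΛ cB : ℝ)
    (hS : ∀ j, LocStencil (unitS (sfStep Lc j) (smStep 3 Lc j) (ScombOf tabs ((Lc : ℝ) ^ 4) (-((Lc : ℝ) ^ 8 / 2)) cΛ j)) Cs δS)
    (hSall : ∀ k j, LocStencil (unitS (sfStep Lc (k + j)) (smStep 3 Lc (k + j)) (ScombOf tabs ((Lc : ℝ) ^ 4) (-((Lc : ℝ) ^ 8 / 2)) cΛ (k + j)) -
      unitS (sfStep Lc k) (smStep 3 Lc k) (ScombOf tabs ((Lc : ℝ) ^ 4) (-((Lc : ℝ) ^ 8 / 2)) cΛ k)) (cS * θS ^ k) δS)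
    (hW : ∀ j, VertexFamily₂ (unitW (sfStep Lc j) (smStep 3 Lc j)
      (WcombOf tabs ((Lc : ℝ) ^ 4) (-((Lc : ℝ) ^ 8 / 2)) cΛ ((Lc : ℝ) ^ 8) cB ((8 * (N : ℝ) ^ 2)⁻¹ • wsym22 N) j - X j)) Lc Cw δW)
    (hWall : ∀ k j, VertexFamily₂ (unitW (sfStep Lc (k + j)) (smStep 3 Lc (k + j))
        (WcombOf tabs ((Lc : ℝ) ^ 4) (-((Lc : ℝ) ^ 8 / 2)) cΛ ((Lc : ℝ) ^ 8) cB ((8 * (N : ℝ) ^ 2)⁻¹ • wsym22 N) (k + j) - X (k + j)) -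
      unitW (sfStep Lc k) (smStep 3 Lc k)
        (WcombOf tabs ((Lc : ℝ) ^ 4) (-((Lc : ℝ) ^ 8 / 2)) cΛ ((Lc : ℝ) ^ 8) cB ((8 * (N : ℝ) ^ 2)⁻¹ • wsym22 N) k - X k)) Lc (cW * θW ^ k) δW)
    (hδS : 0 < δS) (hδW : 0 < δW) (hθS0 : 0 ≤ θS) (hθS1 : θS < 1) (hθW0 : 0 ≤ θW) (hθW1 : θW < 1) (μ ν : Fin 4) :
    ∃ κ θ : ℝ, 0 ≤ θ ∧ θ < 1 ∧ AllScalesSeq (fun j => B12Beta.secondMoment (TbalOf Lc (JsB12CombShSym hLc N tabs cΛ cB) j) μ ν) κ θ := by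
  obtain ⟨C, δK, cK, θK, hδK, hθK0, hθK1, hK, hKall⟩ := kSlotCombSh_holds hLc2
  exact exists_allScalesSeq_JsB12CombShSym_of_kRows_slots_parity X hX hXt hLc N tabs cΛ cB hK hKall hS hSall hW hWall hδK hδS hδW hθK0 hθK1 hθS0
    hθS1 hθW0 hθW1 μ ν

/-! ## §4 Row D1's two readings of the wall at the literal, on the S- and W-slot rows alone (K discharged) -/

/-- [our object; folklore composition] **ROW D1's VALUE READING, K DISCHARGED**: on the S-slot rows and the W-slot rows modulo any localised parity-odd `X`
(`Lc` odd, `2 ≤ Lc`), for every channel and every colour parameter `Nc`,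
`D1Drift Lc (JsB12CombShSym …) Nc μ ν ↔ lim_j secondMoment (TbalOf Lc (JsB12CombShSym …) j) μ ν = stepBal Nc Lc`
(`HessKerDressedCauchy.d1Drift_iff_lim_eq` at §3).  The value identity itself is row D1's and is NOT proved here. -/
theorem d1Drift_JsB12CombShSym_iff_lim_eq_of_slots_parity
    (X : ℕ → Fin (3 + 1) → (Fin (3 + 1) → ℤ) → Fin (3 + 1) → (Fin (3 + 1) → ℤ) → MKer (3 + 1) (Fib 3))
    (hX : ∀ j μ ν z, Loc (X j μ 0 ν z)) (hXt : ∀ j μ ν z, trK (X j μ 0 ν z) = -sgnK (X j μ 0 ν z))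
    (hLc : Odd Lc) (hLc2 : 2 ≤ Lc) (N : ℕ) (tabs : SymTables 3 Lc) (cΛ cB : ℝ)
    (hS : ∀ j, LocStencil (unitS (sfStep Lc j) (smStep 3 Lc j) (ScombOf tabs ((Lc : ℝ) ^ 4) (-((Lc : ℝ) ^ 8 / 2)) cΛ j)) Cs δS)
    (hSall : ∀ k j, LocStencil (unitS (sfStep Lc (k + j)) (smStep 3 Lc (k + j)) (ScombOf tabs ((Lc : ℝ) ^ 4) (-((Lc : ℝ) ^ 8 / 2)) cΛ (k + j)) -
      unitS (sfStep Lc k) (smStep 3 Lc k) (ScombOf tabs ((Lc : ℝ) ^ 4) (-((Lc : ℝ) ^ 8 / 2)) cΛ k)) (cS * θS ^ k) δS)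
    (hW : ∀ j, VertexFamily₂ (unitW (sfStep Lc j) (smStep 3 Lc j)
      (WcombOf tabs ((Lc : ℝ) ^ 4) (-((Lc : ℝ) ^ 8 / 2)) cΛ ((Lc : ℝ) ^ 8) cB ((8 * (N : ℝ) ^ 2)⁻¹ • wsym22 N) j - X j)) Lc Cw δW)
    (hWall : ∀ k j, VertexFamily₂ (unitW (sfStep Lc (k + j)) (smStep 3 Lc (k + j))
        (WcombOf tabs ((Lc : ℝ) ^ 4) (-((Lc : ℝ) ^ 8 / 2)) cΛ ((Lc : ℝ) ^ 8) cB ((8 * (N : ℝ) ^ 2)⁻¹ • wsym22 N) (k + j) - X (k + j)) -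
      unitW (sfStep Lc k) (smStep 3 Lc k)
        (WcombOf tabs ((Lc : ℝ) ^ 4) (-((Lc : ℝ) ^ 8 / 2)) cΛ ((Lc : ℝ) ^ 8) cB ((8 * (N : ℝ) ^ 2)⁻¹ • wsym22 N) k - X k)) Lc (cW * θW ^ k) δW)
    (hδS : 0 < δS) (hδW : 0 < δW) (hθS0 : 0 ≤ θS) (hθS1 : θS < 1) (hθW0 : 0 ≤ θW) (hθW1 : θW < 1) (μ ν : Fin 4) (Nc : ℝ) :
    D1Drift Lc (JsB12CombShSym hLc N tabs cΛ cB) Nc μ ν ↔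
      RateCertificate.CauchyRate.lim (fun j => B12Beta.secondMoment (TbalOf Lc (JsB12CombShSym hLc N tabs cΛ cB) j) μ ν) =
        B12Normalization.stepBal Nc Lc := by
  obtain ⟨κ, θ, hθ0, hθ1, hall⟩ := exists_allScalesSeq_JsB12CombShSym_of_slots_parity X hX hXt hLc hLc2 N tabs cΛ cB hS hSall hW hWall
    hδS hδW hθS0 hθS1 hθW0 hθW1 μ ν
  exact d1Drift_iff_lim_eq _ hall hθ0 hθ1 Nc

/-- [our object; folklore composition] **ROW D1's CESÀRO READING, K DISCHARGED**: same rows,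
`D1Drift Lc (JsB12CombShSym …) Nc μ ν ↔ (Σ_{j<m} secondMoment (TbalOf Lc (JsB12CombShSym …) j) μ ν)∕m → stepBal Nc Lc`
(`D1BFx.RoadEnd.d1Drift_iff_cesaro` at §3). -/
theorem d1Drift_JsB12CombShSym_iff_cesaro_of_slots_parity
    (X : ℕ → Fin (3 + 1) → (Fin (3 + 1) → ℤ) → Fin (3 + 1) → (Fin (3 + 1) → ℤ) → MKer (3 + 1) (Fib 3))
    (hX : ∀ j μ ν z, Loc (X j μ 0 ν z)) (hXt : ∀ j μ ν z, trK (X j μ 0 ν z) = -sgnK (X j μ 0 ν z))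
    (hLc : Odd Lc) (hLc2 : 2 ≤ Lc) (N : ℕ) (tabs : SymTables 3 Lc) (cΛ cB : ℝ)
    (hS : ∀ j, LocStencil (unitS (sfStep Lc j) (smStep 3 Lc j) (ScombOf tabs ((Lc : ℝ) ^ 4) (-((Lc : ℝ) ^ 8 / 2)) cΛ j)) Cs δS)
    (hSall : ∀ k j, LocStencil (unitS (sfStep Lc (k + j)) (smStep 3 Lc (k + j)) (ScombOf tabs ((Lc : ℝ) ^ 4) (-((Lc : ℝ) ^ 8 / 2)) cΛ (k + j)) -
      unitS (sfStep Lc k) (smStep 3 Lc k) (ScombOf tabs ((Lc : ℝ) ^ 4) (-((Lc : ℝ) ^ 8 / 2)) cΛ k)) (cS * θS ^ k) δS)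
    (hW : ∀ j, VertexFamily₂ (unitW (sfStep Lc j) (smStep 3 Lc j)
      (WcombOf tabs ((Lc : ℝ) ^ 4) (-((Lc : ℝ) ^ 8 / 2)) cΛ ((Lc : ℝ) ^ 8) cB ((8 * (N : ℝ) ^ 2)⁻¹ • wsym22 N) j - X j)) Lc Cw δW)
    (hWall : ∀ k j, VertexFamily₂ (unitW (sfStep Lc (k + j)) (smStep 3 Lc (k + j))
        (WcombOf tabs ((Lc : ℝ) ^ 4) (-((Lc : ℝ) ^ 8 / 2)) cΛ ((Lc : ℝ) ^ 8) cB ((8 * (N : ℝ) ^ 2)⁻¹ • wsym22 N) (k + j) - X (k + j)) -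
      unitW (sfStep Lc k) (smStep 3 Lc k)
        (WcombOf tabs ((Lc : ℝ) ^ 4) (-((Lc : ℝ) ^ 8 / 2)) cΛ ((Lc : ℝ) ^ 8) cB ((8 * (N : ℝ) ^ 2)⁻¹ • wsym22 N) k - X k)) Lc (cW * θW ^ k) δW)
    (hδS : 0 < δS) (hδW : 0 < δW) (hθS0 : 0 ≤ θS) (hθS1 : θS < 1) (hθW0 : 0 ≤ θW) (hθW1 : θW < 1) (μ ν : Fin 4) (Nc : ℝ) :
    D1Drift Lc (JsB12CombShSym hLc N tabs cΛ cB) Nc μ ν ↔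
      Tendsto (fun m : ℕ => (∑ j ∈ Finset.range m, B12Beta.secondMoment (TbalOf Lc (JsB12CombShSym hLc N tabs cΛ cB) j) μ ν) / (m : ℝ)) atTop
        (𝓝 (B12Normalization.stepBal Nc Lc)) := by
  obtain ⟨κ, θ, hθ0, hθ1, hall⟩ := exists_allScalesSeq_JsB12CombShSym_of_slots_parity X hX hXt hLc hLc2 N tabs cΛ cB hS hSall hW hWall
    hδS hδW hθS0 hθS1 hθW0 hθW1 μ ν
  exact d1Drift_iff_cesaro _ hall hθ0 hθ1 Nc

/-! ## §5 The END and row D1's readings with the W-rows asked of the EVEN HALF only, K discharged -/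

/-- [our object; folklore composition] **THE (III′) END ON THE S-SLOT ROWS AND THE EVEN-HALF W-SLOT ROWS, K DISCHARGED** (leaf-01 g79's
`CombChartSlotJunction.exists_allScalesSeq_JsB12CombShSym_of_kRows_slots_evenHalf` with `(hK, hKall)` := `kSlotCombSh_holds hLc2`; `Lc` odd, `2 ≤ Lc`). -/
theorem exists_allScalesSeq_JsB12CombShSym_of_slots_evenHalf (hLc : Odd Lc) (hLc2 : 2 ≤ Lc) (N : ℕ) (tabs : SymTables 3 Lc) (cΛ cB : ℝ)
    (hS : ∀ j, LocStencil (unitS (sfStep Lc j) (smStep 3 Lc j) (ScombOf tabs ((Lc : ℝ) ^ 4) (-((Lc : ℝ) ^ 8 / 2)) cΛ j)) Cs δS)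
    (hSall : ∀ k j, LocStencil (unitS (sfStep Lc (k + j)) (smStep 3 Lc (k + j)) (ScombOf tabs ((Lc : ℝ) ^ 4) (-((Lc : ℝ) ^ 8 / 2)) cΛ (k + j)) -
      unitS (sfStep Lc k) (smStep 3 Lc k) (ScombOf tabs ((Lc : ℝ) ^ 4) (-((Lc : ℝ) ^ 8 / 2)) cΛ k)) (cS * θS ^ k) δS)
    (hW : ∀ j, VertexFamily₂ (unitW (sfStep Lc j) (smStep 3 Lc j)
      (fun μ z ν z' => ((1 : ℝ) / 2) •
        (WcombOf tabs ((Lc : ℝ) ^ 4) (-((Lc : ℝ) ^ 8 / 2)) cΛ ((Lc : ℝ) ^ 8) cB ((8 * (N : ℝ) ^ 2)⁻¹ • wsym22 N) j μ z ν z'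
          + sgnK (trK (WcombOf tabs ((Lc : ℝ) ^ 4) (-((Lc : ℝ) ^ 8 / 2)) cΛ ((Lc : ℝ) ^ 8) cB ((8 * (N : ℝ) ^ 2)⁻¹ • wsym22 N) j μ z ν z'))))) Lc Cw δW)
    (hWall : ∀ k j, VertexFamily₂ (unitW (sfStep Lc (k + j)) (smStep 3 Lc (k + j))
        (fun μ z ν z' => ((1 : ℝ) / 2) •
          (WcombOf tabs ((Lc : ℝ) ^ 4) (-((Lc : ℝ) ^ 8 / 2)) cΛ ((Lc : ℝ) ^ 8) cB ((8 * (N : ℝ) ^ 2)⁻¹ • wsym22 N) (k + j) μ z ν z'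
            + sgnK (trK (WcombOf tabs ((Lc : ℝ) ^ 4) (-((Lc : ℝ) ^ 8 / 2)) cΛ ((Lc : ℝ) ^ 8) cB ((8 * (N : ℝ) ^ 2)⁻¹ • wsym22 N) (k + j) μ z ν z')))) -
      unitW (sfStep Lc k) (smStep 3 Lc k)
        (fun μ z ν z' => ((1 : ℝ) / 2) •
          (WcombOf tabs ((Lc : ℝ) ^ 4) (-((Lc : ℝ) ^ 8 / 2)) cΛ ((Lc : ℝ) ^ 8) cB ((8 * (N : ℝ) ^ 2)⁻¹ • wsym22 N) k μ z ν z'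
            + sgnK (trK (WcombOf tabs ((Lc : ℝ) ^ 4) (-((Lc : ℝ) ^ 8 / 2)) cΛ ((Lc : ℝ) ^ 8) cB ((8 * (N : ℝ) ^ 2)⁻¹ • wsym22 N) k μ z ν z'))))) Lc
      (cW * θW ^ k) δW)
    (hδS : 0 < δS) (hδW : 0 < δW) (hθS0 : 0 ≤ θS) (hθS1 : θS < 1) (hθW0 : 0 ≤ θW) (hθW1 : θW < 1) (μ ν : Fin 4) :
    ∃ κ θ : ℝ, 0 ≤ θ ∧ θ < 1 ∧ AllScalesSeq (fun j => B12Beta.secondMoment (TbalOf Lc (JsB12CombShSym hLc N tabs cΛ cB) j) μ ν) κ θ := by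
  obtain ⟨C, δK, cK, θK, hδK, hθK0, hθK1, hK, hKall⟩ := kSlotCombSh_holds hLc2
  exact exists_allScalesSeq_JsB12CombShSym_of_kRows_slots_evenHalf hLc N tabs cΛ cB hK hKall hS hSall hW hWall hδK hδS hδW hθK0 hθK1 hθS0
    hθS1 hθW0 hθW1 μ ν

/-- [our object; folklore composition] **ROW D1's VALUE READING ON THE EVEN-HALF ROWS, K DISCHARGED** (leaf-01's `…_iff_lim_eq_of_kRows_slots_evenHalf` likewise). -/
theorem d1Drift_JsB12CombShSym_iff_lim_eq_of_slots_evenHalf (hLc : Odd Lc) (hLc2 : 2 ≤ Lc) (N : ℕ) (tabs : SymTables 3 Lc) (cΛ cB : ℝ)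
    (hS : ∀ j, LocStencil (unitS (sfStep Lc j) (smStep 3 Lc j) (ScombOf tabs ((Lc : ℝ) ^ 4) (-((Lc : ℝ) ^ 8 / 2)) cΛ j)) Cs δS)
    (hSall : ∀ k j, LocStencil (unitS (sfStep Lc (k + j)) (smStep 3 Lc (k + j)) (ScombOf tabs ((Lc : ℝ) ^ 4) (-((Lc : ℝ) ^ 8 / 2)) cΛ (k + j)) -
      unitS (sfStep Lc k) (smStep 3 Lc k) (ScombOf tabs ((Lc : ℝ) ^ 4) (-((Lc : ℝ) ^ 8 / 2)) cΛ k)) (cS * θS ^ k) δS)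
    (hW : ∀ j, VertexFamily₂ (unitW (sfStep Lc j) (smStep 3 Lc j)
      (fun μ z ν z' => ((1 : ℝ) / 2) •
        (WcombOf tabs ((Lc : ℝ) ^ 4) (-((Lc : ℝ) ^ 8 / 2)) cΛ ((Lc : ℝ) ^ 8) cB ((8 * (N : ℝ) ^ 2)⁻¹ • wsym22 N) j μ z ν z'
          + sgnK (trK (WcombOf tabs ((Lc : ℝ) ^ 4) (-((Lc : ℝ) ^ 8 / 2)) cΛ ((Lc : ℝ) ^ 8) cB ((8 * (N : ℝ) ^ 2)⁻¹ • wsym22 N) j μ z ν z'))))) Lc Cw δW)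
    (hWall : ∀ k j, VertexFamily₂ (unitW (sfStep Lc (k + j)) (smStep 3 Lc (k + j))
        (fun μ z ν z' => ((1 : ℝ) / 2) •
          (WcombOf tabs ((Lc : ℝ) ^ 4) (-((Lc : ℝ) ^ 8 / 2)) cΛ ((Lc : ℝ) ^ 8) cB ((8 * (N : ℝ) ^ 2)⁻¹ • wsym22 N) (k + j) μ z ν z'
            + sgnK (trK (WcombOf tabs ((Lc : ℝ) ^ 4) (-((Lc : ℝ) ^ 8 / 2)) cΛ ((Lc : ℝ) ^ 8) cB ((8 * (N : ℝ) ^ 2)⁻¹ • wsym22 N) (k + j) μ z ν z')))) -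
      unitW (sfStep Lc k) (smStep 3 Lc k)
        (fun μ z ν z' => ((1 : ℝ) / 2) •
          (WcombOf tabs ((Lc : ℝ) ^ 4) (-((Lc : ℝ) ^ 8 / 2)) cΛ ((Lc : ℝ) ^ 8) cB ((8 * (N : ℝ) ^ 2)⁻¹ • wsym22 N) k μ z ν z'
            + sgnK (trK (WcombOf tabs ((Lc : ℝ) ^ 4) (-((Lc : ℝ) ^ 8 / 2)) cΛ ((Lc : ℝ) ^ 8) cB ((8 * (N : ℝ) ^ 2)⁻¹ • wsym22 N) k μ z ν z'))))) Lc
      (cW * θW ^ k) δW)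
    (hδS : 0 < δS) (hδW : 0 < δW) (hθS0 : 0 ≤ θS) (hθS1 : θS < 1) (hθW0 : 0 ≤ θW) (hθW1 : θW < 1) (μ ν : Fin 4) (Nc : ℝ) :
    D1Drift Lc (JsB12CombShSym hLc N tabs cΛ cB) Nc μ ν ↔
      RateCertificate.CauchyRate.lim (fun j => B12Beta.secondMoment (TbalOf Lc (JsB12CombShSym hLc N tabs cΛ cB) j) μ ν) =
        B12Normalization.stepBal Nc Lc := by
  obtain ⟨C, δK, cK, θK, hδK, hθK0, hθK1, hK, hKall⟩ := kSlotCombSh_holds hLc2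
  exact d1Drift_JsB12CombShSym_iff_lim_eq_of_kRows_slots_evenHalf hLc N tabs cΛ cB hK hKall hS hSall hW hWall hδK hδS hδW hθK0 hθK1 hθS0
    hθS1 hθW0 hθW1 μ ν Nc

/-- [our object; folklore composition] **ROW D1's CESÀRO READING ON THE EVEN-HALF ROWS, K DISCHARGED** (leaf-01's `…_iff_cesaro_of_kRows_slots_evenHalf` likewise). -/
theorem d1Drift_JsB12CombShSym_iff_cesaro_of_slots_evenHalf (hLc : Odd Lc) (hLc2 : 2 ≤ Lc) (N : ℕ) (tabs : SymTables 3 Lc) (cΛ cB : ℝ)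
    (hS : ∀ j, LocStencil (unitS (sfStep Lc j) (smStep 3 Lc j) (ScombOf tabs ((Lc : ℝ) ^ 4) (-((Lc : ℝ) ^ 8 / 2)) cΛ j)) Cs δS)
    (hSall : ∀ k j, LocStencil (unitS (sfStep Lc (k + j)) (smStep 3 Lc (k + j)) (ScombOf tabs ((Lc : ℝ) ^ 4) (-((Lc : ℝ) ^ 8 / 2)) cΛ (k + j)) -
      unitS (sfStep Lc k) (smStep 3 Lc k) (ScombOf tabs ((Lc : ℝ) ^ 4) (-((Lc : ℝ) ^ 8 / 2)) cΛ k)) (cS * θS ^ k) δS)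
    (hW : ∀ j, VertexFamily₂ (unitW (sfStep Lc j) (smStep 3 Lc j)
      (fun μ z ν z' => ((1 : ℝ) / 2) •
        (WcombOf tabs ((Lc : ℝ) ^ 4) (-((Lc : ℝ) ^ 8 / 2)) cΛ ((Lc : ℝ) ^ 8) cB ((8 * (N : ℝ) ^ 2)⁻¹ • wsym22 N) j μ z ν z'
          + sgnK (trK (WcombOf tabs ((Lc : ℝ) ^ 4) (-((Lc : ℝ) ^ 8 / 2)) cΛ ((Lc : ℝ) ^ 8) cB ((8 * (N : ℝ) ^ 2)⁻¹ • wsym22 N) j μ z ν z'))))) Lc Cw δW)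
    (hWall : ∀ k j, VertexFamily₂ (unitW (sfStep Lc (k + j)) (smStep 3 Lc (k + j))
        (fun μ z ν z' => ((1 : ℝ) / 2) •
          (WcombOf tabs ((Lc : ℝ) ^ 4) (-((Lc : ℝ) ^ 8 / 2)) cΛ ((Lc : ℝ) ^ 8) cB ((8 * (N : ℝ) ^ 2)⁻¹ • wsym22 N) (k + j) μ z ν z'
            + sgnK (trK (WcombOf tabs ((Lc : ℝ) ^ 4) (-((Lc : ℝ) ^ 8 / 2)) cΛ ((Lc : ℝ) ^ 8) cB ((8 * (N : ℝ) ^ 2)⁻¹ • wsym22 N) (k + j) μ z ν z')))) -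
      unitW (sfStep Lc k) (smStep 3 Lc k)
        (fun μ z ν z' => ((1 : ℝ) / 2) •
          (WcombOf tabs ((Lc : ℝ) ^ 4) (-((Lc : ℝ) ^ 8 / 2)) cΛ ((Lc : ℝ) ^ 8) cB ((8 * (N : ℝ) ^ 2)⁻¹ • wsym22 N) k μ z ν z'
            + sgnK (trK (WcombOf tabs ((Lc : ℝ) ^ 4) (-((Lc : ℝ) ^ 8 / 2)) cΛ ((Lc : ℝ) ^ 8) cB ((8 * (N : ℝ) ^ 2)⁻¹ • wsym22 N) k μ z ν z'))))) Lc
      (cW * θW ^ k) δW)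
    (hδS : 0 < δS) (hδW : 0 < δW) (hθS0 : 0 ≤ θS) (hθS1 : θS < 1) (hθW0 : 0 ≤ θW) (hθW1 : θW < 1) (μ ν : Fin 4) (Nc : ℝ) :
    D1Drift Lc (JsB12CombShSym hLc N tabs cΛ cB) Nc μ ν ↔
      Tendsto (fun m : ℕ => (∑ j ∈ Finset.range m, B12Beta.secondMoment (TbalOf Lc (JsB12CombShSym hLc N tabs cΛ cB) j) μ ν) / (m : ℝ)) atTop
        (𝓝 (B12Normalization.stepBal Nc Lc)) := by
  obtain ⟨C, δK, cK, θK, hδK, hθK0, hθK1, hK, hKall⟩ := kSlotCombSh_holds hLc2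
  exact d1Drift_JsB12CombShSym_iff_cesaro_of_kRows_slots_evenHalf hLc N tabs cΛ cB hK hKall hS hSall hW hWall hδK hδS hδW hθK0 hθK1 hθS0
    hθS1 hθW0 hθW1 μ ν Nc

/-! ## §6 The (III′) END with the S-slot socketed on road-P2's SECTOR letters (v1.3, APPEND-ONLY) -/

/-- [our object; folklore composition] **THE G-an2-4 END AT (III′), S-SLOT SOCKETED ON THE WILSON-LINEAGE AND BORN-REMAINDER ROWS, K DISCHARGED** (`Lc` odd, `2 ≤ Lc`,
every `N tabs cΛ cB`, channel): §1 with the pair `(hS, hSall)` on `unitS_j (ScombOf tabs Lc⁴ (−Lc⁸∕2) cΛ j)` supplied by road-P2 g56's M.53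
`CombSRowsOfSectors.exists_hS_hSall_ScombOf_of_sectors` from FOUR SECTOR LETTERS — (S-W0) ∕ (S-Wd): uniform localisation ∕ all-scales Cauchy rows of the unit tables of the
WILSON LINEAGE `combWilsonAt Lc Lc⁴` (M.50), (S-B0) ∕ (S-Bd): the same for the BORN REMAINDER `combBornOf Lc tabs Lc⁴ (−Lc⁸∕2) cΛ`; the two S-radii are merged to their `min`
(`locStencil_mono'`); the W-slot rows `(hW, hWall)` are displayed as in §1.  Discharges NO sector letter. -/
theorem exists_allScalesSeq_JsB12CombShSym_of_sectors (hLc : Odd Lc) (hLc2 : 2 ≤ Lc) (N : ℕ) (tabs : SymTables 3 Lc) (cΛ cB : ℝ)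
    (hSl : ∃ Cl δl : ℝ, 0 < δl ∧ ∀ j : ℕ, LocStencil (unitS (sfStep Lc j) (smStep 3 Lc j) (combWilsonAt (d := 3) Lc ((Lc : ℝ) ^ 4) j)) Cl δl)
    (hSb : ∃ Cb δb : ℝ, 0 < δb ∧ ∀ j : ℕ,
      LocStencil (unitS (sfStep Lc j) (smStep 3 Lc j) (combBornOf Lc tabs ((Lc : ℝ) ^ 4) (-((Lc : ℝ) ^ 8 / 2)) cΛ j)) Cb δb)
    (hSld : ∃ cl θl δl : ℝ, 0 ≤ cl ∧ 0 ≤ θl ∧ θl < 1 ∧ 0 < δl ∧ ∀ k j : ℕ,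
      LocStencil (unitS (sfStep Lc (k + j)) (smStep 3 Lc (k + j)) (combWilsonAt (d := 3) Lc ((Lc : ℝ) ^ 4) (k + j))
        - unitS (sfStep Lc k) (smStep 3 Lc k) (combWilsonAt (d := 3) Lc ((Lc : ℝ) ^ 4) k)) (cl * θl ^ k) δl)
    (hSbd : ∃ cb θb δb : ℝ, 0 ≤ cb ∧ 0 ≤ θb ∧ θb < 1 ∧ 0 < δb ∧ ∀ k j : ℕ,
      LocStencil (unitS (sfStep Lc (k + j)) (smStep 3 Lc (k + j)) (combBornOf Lc tabs ((Lc : ℝ) ^ 4) (-((Lc : ℝ) ^ 8 / 2)) cΛ (k + j))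
        - unitS (sfStep Lc k) (smStep 3 Lc k) (combBornOf Lc tabs ((Lc : ℝ) ^ 4) (-((Lc : ℝ) ^ 8 / 2)) cΛ k)) (cb * θb ^ k) δb)
    (hW : ∀ j, VertexFamily₂ (unitW (sfStep Lc j) (smStep 3 Lc j)
      (WcombOf tabs ((Lc : ℝ) ^ 4) (-((Lc : ℝ) ^ 8 / 2)) cΛ ((Lc : ℝ) ^ 8) cB ((8 * (N : ℝ) ^ 2)⁻¹ • wsym22 N) j)) Lc Cw δW)
    (hWall : ∀ k j, VertexFamily₂ (unitW (sfStep Lc (k + j)) (smStep 3 Lc (k + j))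
        (WcombOf tabs ((Lc : ℝ) ^ 4) (-((Lc : ℝ) ^ 8 / 2)) cΛ ((Lc : ℝ) ^ 8) cB ((8 * (N : ℝ) ^ 2)⁻¹ • wsym22 N) (k + j)) -
      unitW (sfStep Lc k) (smStep 3 Lc k)
        (WcombOf tabs ((Lc : ℝ) ^ 4) (-((Lc : ℝ) ^ 8 / 2)) cΛ ((Lc : ℝ) ^ 8) cB ((8 * (N : ℝ) ^ 2)⁻¹ • wsym22 N) k)) Lc (cW * θW ^ k) δW)
    (hδW : 0 < δW) (hθW0 : 0 ≤ θW) (hθW1 : θW < 1) (μ ν : Fin 4) :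
    ∃ κ θ : ℝ, 0 ≤ θ ∧ θ < 1 ∧ AllScalesSeq (fun j => B12Beta.secondMoment (TbalOf Lc (JsB12CombShSym hLc N tabs cΛ cB) j) μ ν) κ θ := by
  obtain ⟨⟨Cs', δ₁, hδ₁, hS⟩, ⟨cS', θS', δ₂, -, hθS0, hθS1, hδ₂, hSall⟩⟩ :=
    exists_hS_hSall_ScombOf_of_sectors tabs ((Lc : ℝ) ^ 4) (-((Lc : ℝ) ^ 8 / 2)) cΛ hSl hSb hSld hSbd
  have hS' : ∀ j, LocStencil (unitS (sfStep Lc j) (smStep 3 Lc j) (ScombOf tabs ((Lc : ℝ) ^ 4) (-((Lc : ℝ) ^ 8 / 2)) cΛ j)) Cs' (min δ₁ δ₂) :=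
    fun j => locStencil_mono' (hS j) le_rfl (min_le_left _ _)
  have hSall' : ∀ k j, LocStencil (unitS (sfStep Lc (k + j)) (smStep 3 Lc (k + j)) (ScombOf tabs ((Lc : ℝ) ^ 4) (-((Lc : ℝ) ^ 8 / 2)) cΛ (k + j)) -
      unitS (sfStep Lc k) (smStep 3 Lc k) (ScombOf tabs ((Lc : ℝ) ^ 4) (-((Lc : ℝ) ^ 8 / 2)) cΛ k)) (cS' * θS' ^ k) (min δ₁ δ₂) :=
    fun k j => locStencil_mono' (hSall k j) le_rfl (min_le_right _ _)
  exact exists_allScalesSeq_JsB12CombShSym_of_slots hLc hLc2 N tabs cΛ cB hS' hSall' hW hWall (lt_min hδ₁ hδ₂) hδW hθS0 hθS1 hθW0 hθW1 μ ν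

/-- [our object; folklore composition] **THE WALL ⟺ THE IDENTIFICATION AT THE CONSTRUCTED LIMITS, S-SLOT SOCKETED ON THE SECTOR LETTERS, K DISCHARGED** (§2's
`d1Drift_JsB12CombShSym_iff_of_slots` under (S-W0)(S-B0)(S-Wd)(S-Bd) ∧ (hW, hWall); every colour `Nc`). -/
theorem d1Drift_JsB12CombShSym_iff_of_sectors (hLc : Odd Lc) (hLc2 : 2 ≤ Lc) (N : ℕ) (tabs : SymTables 3 Lc) (cΛ cB : ℝ)
    (hSl : ∃ Cl δl : ℝ, 0 < δl ∧ ∀ j : ℕ, LocStencil (unitS (sfStep Lc j) (smStep 3 Lc j) (combWilsonAt (d := 3) Lc ((Lc : ℝ) ^ 4) j)) Cl δl)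
    (hSb : ∃ Cb δb : ℝ, 0 < δb ∧ ∀ j : ℕ,
      LocStencil (unitS (sfStep Lc j) (smStep 3 Lc j) (combBornOf Lc tabs ((Lc : ℝ) ^ 4) (-((Lc : ℝ) ^ 8 / 2)) cΛ j)) Cb δb)
    (hSld : ∃ cl θl δl : ℝ, 0 ≤ cl ∧ 0 ≤ θl ∧ θl < 1 ∧ 0 < δl ∧ ∀ k j : ℕ,
      LocStencil (unitS (sfStep Lc (k + j)) (smStep 3 Lc (k + j)) (combWilsonAt (d := 3) Lc ((Lc : ℝ) ^ 4) (k + j))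
        - unitS (sfStep Lc k) (smStep 3 Lc k) (combWilsonAt (d := 3) Lc ((Lc : ℝ) ^ 4) k)) (cl * θl ^ k) δl)
    (hSbd : ∃ cb θb δb : ℝ, 0 ≤ cb ∧ 0 ≤ θb ∧ θb < 1 ∧ 0 < δb ∧ ∀ k j : ℕ,
      LocStencil (unitS (sfStep Lc (k + j)) (smStep 3 Lc (k + j)) (combBornOf Lc tabs ((Lc : ℝ) ^ 4) (-((Lc : ℝ) ^ 8 / 2)) cΛ (k + j))
        - unitS (sfStep Lc k) (smStep 3 Lc k) (combBornOf Lc tabs ((Lc : ℝ) ^ 4) (-((Lc : ℝ) ^ 8 / 2)) cΛ k)) (cb * θb ^ k) δb)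
    (hW : ∀ j, VertexFamily₂ (unitW (sfStep Lc j) (smStep 3 Lc j)
      (WcombOf tabs ((Lc : ℝ) ^ 4) (-((Lc : ℝ) ^ 8 / 2)) cΛ ((Lc : ℝ) ^ 8) cB ((8 * (N : ℝ) ^ 2)⁻¹ • wsym22 N) j)) Lc Cw δW)
    (hWall : ∀ k j, VertexFamily₂ (unitW (sfStep Lc (k + j)) (smStep 3 Lc (k + j))
        (WcombOf tabs ((Lc : ℝ) ^ 4) (-((Lc : ℝ) ^ 8 / 2)) cΛ ((Lc : ℝ) ^ 8) cB ((8 * (N : ℝ) ^ 2)⁻¹ • wsym22 N) (k + j)) -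
      unitW (sfStep Lc k) (smStep 3 Lc k)
        (WcombOf tabs ((Lc : ℝ) ^ 4) (-((Lc : ℝ) ^ 8 / 2)) cΛ ((Lc : ℝ) ^ 8) cB ((8 * (N : ℝ) ^ 2)⁻¹ • wsym22 N) k)) Lc (cW * θW ^ k) δW)
    (hδW : 0 < δW) (hθW0 : 0 ≤ θW) (hθW1 : θW < 1) (μ ν : Fin 4) (Nc : ℝ) :
    D1Drift Lc (JsB12CombShSym hLc N tabs cΛ cB) Nc μ ν ↔
      B12Beta.secondMoment
        (hessKer (limMKerOf fun j => unitK (sfStep Lc j) (smStep 3 Lc j) (GcombSh (d := 3) Lc j))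
          (vertexOfK (limMKerOf fun j => unitK (sfStep Lc j) (smStep 3 Lc j) (GcombSh (d := 3) Lc j)) Lc
            (limStOf fun j => unitS (sfStep Lc j) (smStep 3 Lc j) (ScombOf tabs ((Lc : ℝ) ^ 4) (-((Lc : ℝ) ^ 8 / 2)) cΛ j)))
          (limTabOf fun j => unitW (sfStep Lc j) (smStep 3 Lc j)
            (WcombOf tabs ((Lc : ℝ) ^ 4) (-((Lc : ℝ) ^ 8 / 2)) cΛ ((Lc : ℝ) ^ 8) cB ((8 * (N : ℝ) ^ 2)⁻¹ • wsym22 N) j))) μ ν =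
        B12Normalization.stepBal Nc Lc := by
  obtain ⟨⟨Cs', δ₁, hδ₁, hS⟩, ⟨cS', θS', δ₂, -, hθS0, hθS1, hδ₂, hSall⟩⟩ :=
    exists_hS_hSall_ScombOf_of_sectors tabs ((Lc : ℝ) ^ 4) (-((Lc : ℝ) ^ 8 / 2)) cΛ hSl hSb hSld hSbd
  have hS' : ∀ j, LocStencil (unitS (sfStep Lc j) (smStep 3 Lc j) (ScombOf tabs ((Lc : ℝ) ^ 4) (-((Lc : ℝ) ^ 8 / 2)) cΛ j)) Cs' (min δ₁ δ₂) :=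
    fun j => locStencil_mono' (hS j) le_rfl (min_le_left _ _)
  have hSall' : ∀ k j, LocStencil (unitS (sfStep Lc (k + j)) (smStep 3 Lc (k + j)) (ScombOf tabs ((Lc : ℝ) ^ 4) (-((Lc : ℝ) ^ 8 / 2)) cΛ (k + j)) -
      unitS (sfStep Lc k) (smStep 3 Lc k) (ScombOf tabs ((Lc : ℝ) ^ 4) (-((Lc : ℝ) ^ 8 / 2)) cΛ k)) (cS' * θS' ^ k) (min δ₁ δ₂) :=
    fun k j => locStencil_mono' (hSall k j) le_rfl (min_le_right _ _)
  exact d1Drift_JsB12CombShSym_iff_of_slots hLc hLc2 N tabs cΛ cB hS' hSall' hW hWall (lt_min hδ₁ hδ₂) hδW hθS0 hθS1 hθW0 hθW1 μ ν Nc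

end Summit.QuantumFields.BalabanUV.Beta.GAN24.CombTowerEndOfSlotsK

end
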